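import Summits.HodgeConjecture.HodgeConjecture.Theorems.F0P3cStCharTSUpTrU2Chart     -- (B1) U2-CHART (this seat): entries criterion, `exists_upper ∕ exists_lower`, the 2×2 conjugation identities
import Summits.HodgeConjecture.HodgeConjecture.Theorems.F0P3cIwahoriDatumU2Alg       -- ★ (LH6-p05): `coe_level_eq_mul` (Iwahori `N̄·T·N` of `K_γ ∩ U(σ,Φ_N)`, any rank), `weylLongU`
import HarnessLib

/-!
# F0 · P3c · line LH6 «StCharTS» — ROAD «UP-TR» brick (H4s), sub-road «JAC-LOC₂» file (B5) «ORBIT-TUBE₂ ⊆»: conjugating the split-torus coset `s·M_γ` of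
# `U(1,1) = U(σ,Φ₂)(K)` by the level `K_γ` lands in `s · N̄[γ|a−1|] · M_γ · N[γ|a⁻¹−1|]` (Harish-Chandra 1970 Lemma 22; van Dijk 1972 §2; Casselman 1995 Prop. 1.4.4)

Cell `pub/hodgecm-mathlib`, crux H413 = `stmt-HodgeConjecture-24833` (lane `--supports … --as helper`); seat LH7-p02 (g8), typing hand of (H4s) «JAC-H-SPLIT» and
sub-dealer of «JAC-LOC₂» (memo `F0/P3c/LH7/LH7-p02/g8/h4s/ROAD-JAC-LOC2.v1.LH7p02g8.md` §2).  THEOREMS ONLY; sorry-free; no definition ∕ instance ∕ notation ∕ named fact;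
★-only imports; axioms TRIO.

THE MATHEMATICS.  `K` a field with a valuation `v`, `σ` an ISOMETRIC endomorphism (`v(σx) = v(x)`), `U′ = U(σ,Φ₂)(K)`, split torus `M = {m(d,e)}` (`σd·e = 1`),
root value `a(m) = m₀₀·σ(m₀₀)` (`m⁻¹u(y)m = u(y∕a)`, `m⁻¹ū(z)m = ū(az)`, ★ (B1) §4), levels `K_γ` (★ `congruenceGL`).  For `s ∈ M` with `a = a(s) ≠ 1` and `γ < 1` SMALL
W.R.T. `s` — `γ·v(a) < v(a−1)`, `γ < v(a−1)`, `γ·v(a⁻¹−1) ≤ 1` — every `k ∈ K_γ ∩ U′`, `τ ∈ M ∩ K_γ` satisfy (`conj_mul_mem_orbitTube`)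
  **`k · (sτ) · k⁻¹ = s · n̄ · m · n`**,  `n̄ = ū(Z)`, `v(Z) ≤ γ·v(a−1)`, `m ∈ M ∩ K_γ`, `n = u(Y)`, `v(Y) ≤ γ·v(a⁻¹−1)`.
PROOF: Iwahori `k = n̄₀ τ₀ n₀` (★ `coe_level_eq_mul`, order `N̄·T·N`, coordinates `z, (d₀,e₀), y`); the matrix of `k (sτ) k⁻¹` is computed EXACTLY (§2 (4):
`!![D + a₀yz(D−E), a₀y(E−D); z(D−E)(1+a₀yz), E + a₀yz(E−D)]`, `D = d d₁`, `E = e e₁`, `a₀ = d₀σd₀`); `W := s⁻¹ k (sτ) k⁻¹` has `v(W₀₀ − 1) ≤ γ`,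
`v(W₁₀) ≤ γ v(a−1)`, `v(W₀₁) ≤ γ v(a⁻¹−1)` (key: `D − E = e·((a−1) + a(d₁−1) − (e₁−1))` so `v(D−E) = v(e)·v(a−1)` by the two strict margins), and §0 — the BIG-CELL
decomposition `g = ū(g₁₀p′)·m·u(p′g₀₁)` of ANY member with `p′ g₀₀ = 1` (generic commutative ring) — splits `W`.  This is the «⊆» half of ORBIT-TUBE₂
`Ad(K_γ)(s·M_γ) = s · N̄[γ|a−1|] · M_γ · N[γ|a⁻¹−1|]`; «⊇» is (B6) (LH7-p03 (g6)), the measure of the right side (B5-M) (A-p12 (g30)), the model socket (B7) (LH1-p03 (g10)).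
HONEST LABEL: count-neutral algebra; closes no organ; HC_CM is proved only modulo the 7 printed citations (2 remaining: hLiu418 = `stmt-HodgeConjecture-24832`, h413 =
`stmt-HodgeConjecture-24833`) until rung 0 closes.

## References
* [HarishChandra1970] Harish-Chandra (notes by G. van Dijk), *Harmonic analysis on reductive p-adic groups*, LNM 162 (1970), Part V §4 Lemma 22.
* [vanDijk1972] G. van Dijk, *Computation of certain induced characters of p-adic groups*, Math. Ann. 199 (1972), §2.
* [Casselman1995] W. Casselman, *Introduction to the theory of admissible representations of `p`-adic reductive groups* (1995 notes), Prop. 1.4.4.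
* [Rogawski1990] J. D. Rogawski, *Automorphic Representations of Unitary Groups in Three Variables* (1990), §1.10 p. 9, §12.5 p. 182.
-/

set_option autoImplicit false
-- the mandated namespace has the single-problem summit's repeated segment (`HodgeConjecture.HodgeConjecture`)
set_option linter.dupNamespace false

open Matrix ValuativeRel
open Literature.NumberTheory.Automorphic Literature.NumberTheory.Automorphic.UnitaryGroup
open Summit.HodgeConjecture.HodgeConjecture.Cruxes.H413.F0P3bBorelCharactersUnipotentTwo
open Summit.HodgeConjecture.HodgeConjecture.Cruxes.H413.F0P3cStCharTSUpTrU2Chart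
open Summit.HodgeConjecture.HodgeConjecture.Cruxes.H413.F0P3cIwahoriDatumU2
open scoped MatrixGroups Pointwise

namespace Summit.HodgeConjecture.HodgeConjecture.Cruxes.H413.F0P3cStCharTSUpTrU2OrbitTube

/-! ## §0 The big-cell (`N̄·M·N`) decomposition of a member whose upper-left entry is a unit (generic commutative ring) -/

section BigCell

variable {R : Type*} [CommRing R] (σ : R →+* R) {J : Matrix (Fin 2) (Fin 2) R} (hJ : J = (StdForm.antidiagonal 2).over R)

include hJ in
/-- **THE BIG-CELL DECOMPOSITION IN `U(σ, Φ₂)(R)`.**  If `g ∈ U(σ,Φ₂)(R)` has an invertible upper-left entry (`p′ g₀₀ = 1`) then `g = n̄ · m · n` with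
`n̄ = ū(g₁₀ p′)`, `m = !![g₀₀, 0; 0, g₁₁ − g₁₀ p′ g₀₁] ∈ M` and `n = u(p′ g₀₁)` — all three MEMBERS of `U(σ,Φ₂)(R)`: `g₁₀ p′` is `σ`-skew by the first entry identity of §1,
`n̄⁻¹ g` is upper triangular and unitary, so its diagonal is a torus element (§2 `exists_diag`) and the remaining factor is the unipotent `u(p′ g₀₁)`.  (The refactorisation of ★
`eq_lower_mul_diag_mul_upper`, read inside the group.) [cite: Casselman1995, Prop. 1.4.4] [cite: Rogawski1990, §1.10 p. 9] -/
theorem exists_lower_torus_upper_of_mul_entry_eq_one {g : ↥(unitaryGroupOfForm σ J)} {p' : R}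
    (hp : p' * ((g : GL (Fin 2) R) : Matrix (Fin 2) (Fin 2) R) 0 0 = 1) :
    ∃ nb m n : ↥(unitaryGroupOfForm σ J),
      ((nb : GL (Fin 2) R) : Matrix (Fin 2) (Fin 2) R) = !![1, 0; ((g : GL (Fin 2) R) : Matrix (Fin 2) (Fin 2) R) 1 0 * p', 1] ∧
      m ∈ torusU σ J ∧
      ((m : GL (Fin 2) R) : Matrix (Fin 2) (Fin 2) R) =
        !![((g : GL (Fin 2) R) : Matrix (Fin 2) (Fin 2) R) 0 0, 0;
           0, ((g : GL (Fin 2) R) : Matrix (Fin 2) (Fin 2) R) 1 1 - ((g : GL (Fin 2) R) : Matrix (Fin 2) (Fin 2) R) 1 0 * p' * ((g : GL (Fin 2) R) : Matrix (Fin 2) (Fin 2) R) 0 1] ∧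
      ((n : GL (Fin 2) R) : Matrix (Fin 2) (Fin 2) R) = !![1, p' * ((g : GL (Fin 2) R) : Matrix (Fin 2) (Fin 2) R) 0 1; 0, 1] ∧
      g = nb * m * n := by
  -- names for the entries
  set g00 := ((g : GL (Fin 2) R) : Matrix (Fin 2) (Fin 2) R) 0 0 with hg00
  set g01 := ((g : GL (Fin 2) R) : Matrix (Fin 2) (Fin 2) R) 0 1 with hg01
  set g10 := ((g : GL (Fin 2) R) : Matrix (Fin 2) (Fin 2) R) 1 0 with hg10
  set g11 := ((g : GL (Fin 2) R) : Matrix (Fin 2) (Fin 2) R) 1 1 with hg11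
  have hgmat : ((g : GL (Fin 2) R) : Matrix (Fin 2) (Fin 2) R) = !![g00, g01; g10, g11] := by
    ext i j; fin_cases i <;> fin_cases j <;> rfl
  obtain ⟨h00, -, -, -⟩ := (mem_unitaryGroupOfForm_two_iff σ hJ (g : GL (Fin 2) R)).1 g.2
  simp only [← hg00, ← hg10] at h00
  -- the lower coordinate `Z = g₁₀ p′` is skew
  have hZ : g10 * p' + σ (g10 * p') = 0 := by
    have hσp : σ p' * σ g00 = 1 := by rw [← map_mul, hp, map_one]
    rw [map_mul]
    linear_combination (p' * σ p') * h00 - (g10 * p') * hσp - (σ g10 * σ p') * hp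
  obtain ⟨nb, hnb, hnbinv⟩ := exists_lower σ hJ hZ
  -- `h := n̄⁻¹ g` is upper triangular
  set h : ↥(unitaryGroupOfForm σ J) := nb⁻¹ * g with hh
  have hhmat : ((h : GL (Fin 2) R) : Matrix (Fin 2) (Fin 2) R) = !![g00, g01; 0, g11 - g10 * p' * g01] := by
    rw [hh, Subgroup.coe_mul, Subgroup.coe_inv, Units.val_mul, hnbinv, hgmat]
    simp only [Matrix.mul_fin_two]
    congr 1
    ext i j; fin_cases i <;> fin_cases j
    · simp
    · simp
    · simp; linear_combination (-g10) * hp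
    · simp; ring
  obtain ⟨-, k01, k10, -⟩ := (mem_unitaryGroupOfForm_two_iff σ hJ (h : GL (Fin 2) R)).1 h.2
  have e00 : ((h : GL (Fin 2) R) : Matrix (Fin 2) (Fin 2) R) 0 0 = g00 := by rw [hhmat]; simp
  have e01 : ((h : GL (Fin 2) R) : Matrix (Fin 2) (Fin 2) R) 0 1 = g01 := by rw [hhmat]; simp
  have e10 : ((h : GL (Fin 2) R) : Matrix (Fin 2) (Fin 2) R) 1 0 = 0 := by rw [hhmat]; simp
  have e11 : ((h : GL (Fin 2) R) : Matrix (Fin 2) (Fin 2) R) 1 1 = g11 - g10 * p' * g01 := by rw [hhmat]; simp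
  rw [e00, e01, e10, e11, map_zero, zero_mul, add_zero] at k01
  rw [e00, e01, e10, e11, mul_zero, zero_add] at k10
  -- the diagonal of `h` is a torus element
  obtain ⟨m, hm, hminv⟩ := exists_diag σ hJ k01 k10
  have hmT : m ∈ torusU σ J := by
    rw [mem_torusU_iff]
    refine ⟨fun i => if i = 0 then ⟨g00, σ (g11 - g10 * p' * g01), ?_, k10⟩ else ⟨g11 - g10 * p' * g01, σ g00, ?_, k01⟩, ?_⟩
    · rw [mul_comm]; exact k10
    · rw [mul_comm]; exact k01
    · apply Units.ext
      rw [coe_glDiagonal, hm]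
      ext i j; fin_cases i <;> fin_cases j <;> simp [Matrix.diagonal]
  -- `n := m⁻¹ h` is the unipotent `u(p′ g₀₁)`
  set n : ↥(unitaryGroupOfForm σ J) := m⁻¹ * h with hn
  have hσe : σ (g11 - g10 * p' * g01) = p' := by
    calc σ (g11 - g10 * p' * g01) = σ (g11 - g10 * p' * g01) * (p' * g00) := by rw [hp, mul_one]
      _ = p' * (σ (g11 - g10 * p' * g01) * g00) := by ring
      _ = p' := by rw [k10, mul_one]
  have hnmat : ((n : GL (Fin 2) R) : Matrix (Fin 2) (Fin 2) R) = !![1, p' * g01; 0, 1] := by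
    rw [hn, Subgroup.coe_mul, Subgroup.coe_inv, Units.val_mul, hminv, hhmat]
    simp only [Matrix.mul_fin_two]
    rw [hσe]
    congr 1
    ext i j; fin_cases i <;> fin_cases j
    · simp; linear_combination hp
    · simp
    · simp
    · simp; exact k01
  refine ⟨nb, m, n, hnb, hmT, hm, hnmat, ?_⟩
  rw [hn, hh]; group

end BigCell

variable {K : Type*} [Field K] [ValuativeRel K] (σ : K →+* K) (hσv : ∀ x, valuation K (σ x) = valuation K x)
  {J : Matrix (Fin 2) (Fin 2) K} (hJ : J = (StdForm.antidiagonal 2).over K)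

/-! ## §1 Small valuation and shape lemmas -/
omit hσv hJ in
/-- Off-diagonal entries of a member of the level `K_γ` have valuation `≤ γ` (they are entries of `g − 1`). [cite: Casselman1995, Prop. 1.4.4] -/
theorem valuation_apply_le_of_mem_congruenceGL {γ : ValueGroupWithZero K} {g : GL (Fin 2) K} (hg : g ∈ congruenceGL 2 γ)
    {i j : Fin 2} (hij : i ≠ j) : valuation K ((g : Matrix (Fin 2) (Fin 2) K) i j) ≤ γ := by
  have h := (mem_congruenceGL_iff.1 hg).2.1 i j
  rwa [Matrix.sub_apply, Matrix.one_apply_ne hij, sub_zero] at h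
omit hσv hJ in
/-- Diagonal entries `x` of a member of `K_γ` satisfy `v(x − 1) ≤ γ`. [cite: Casselman1995, Prop. 1.4.4] -/
theorem valuation_apply_sub_one_le_of_mem_congruenceGL {γ : ValueGroupWithZero K} {g : GL (Fin 2) K} (hg : g ∈ congruenceGL 2 γ)
    (i : Fin 2) : valuation K ((g : Matrix (Fin 2) (Fin 2) K) i i - 1) ≤ γ := by
  have h := (mem_congruenceGL_iff.1 hg).2.1 i i
  rwa [Matrix.sub_apply, Matrix.one_apply_eq] at h
omit hσv hJ σ in
/-- `v(x − 1) ≤ γ < 1` forces `v(x) = 1`. [folklore] -/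
theorem valuation_eq_one_of_sub_one_le {γ : ValueGroupWithZero K} (hγ : γ < 1) {x : K} (h : valuation K (x - 1) ≤ γ) : valuation K x = 1 := by
  have : x = 1 + (x - 1) := by ring
  rw [this]
  exact Valuation.map_one_add_of_lt _ (h.trans_lt hγ)
omit [ValuativeRel K] hσv in
include hJ in
/-- **A member of `N̄ = w₀ N w₀⁻¹` is `ū(x₁₀)` with `σ`-skew coordinate.** [cite: Rogawski1990, §1.10 p. 9] -/
theorem coe_eq_lower_of_mem_conj_unipotentU {x : ↥(unitaryGroupOfForm σ J)}
    (hx : x ∈ (unipotentU σ J).map (MulAut.conj (weylLongU σ hJ)).toMonoidHom) :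
    ((x : GL (Fin 2) K) : Matrix (Fin 2) (Fin 2) K) = !![1, 0; ((x : GL (Fin 2) K) : Matrix (Fin 2) (Fin 2) K) 1 0, 1] ∧
      ((x : GL (Fin 2) K) : Matrix (Fin 2) (Fin 2) K) 1 0 + σ (((x : GL (Fin 2) K) : Matrix (Fin 2) (Fin 2) K) 1 0) = 0 := by
  obtain ⟨n, hn, rfl⟩ := Subgroup.mem_map.1 hx
  have hnmat : ((n : GL (Fin 2) K) : Matrix (Fin 2) (Fin 2) K) = !![1, ((n : GL (Fin 2) K) : Matrix (Fin 2) (Fin 2) K) 0 1; 0, 1] := by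
    subst hJ; exact coe_eq_of_mem_unipotentU_two σ hn
  have hskew := entry_add_map_entry_eq_zero_of_mem_unipotentU σ hJ hn
  have hw : (((weylLongU σ hJ : ↥(unitaryGroupOfForm σ J)) : GL (Fin 2) K) : Matrix (Fin 2) (Fin 2) K) = !![0, 1; 1, 0] := by
    rw [coe_coe_weylLongU, hJ, antidiagonal_two_over_eq]
  have hmat : ((((MulAut.conj (weylLongU σ hJ)).toMonoidHom n : ↥(unitaryGroupOfForm σ J)) : GL (Fin 2) K) : Matrix (Fin 2) (Fin 2) K) =
      !![1, 0; ((n : GL (Fin 2) K) : Matrix (Fin 2) (Fin 2) K) 0 1, 1] := by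
    rw [MulEquiv.coe_toMonoidHom, MulAut.conj_apply, weylLongU_inv_eq, Subgroup.coe_mul, Subgroup.coe_mul, Units.val_mul, Units.val_mul, hw]
    conv_lhs => rw [hnmat]
    simp only [Matrix.mul_fin_two]
    congr 1; ext i j; fin_cases i <;> fin_cases j <;> simp
  have e10 : ((((MulAut.conj (weylLongU σ hJ)).toMonoidHom n : ↥(unitaryGroupOfForm σ J)) : GL (Fin 2) K) : Matrix (Fin 2) (Fin 2) K) 1 0 =
      ((n : GL (Fin 2) K) : Matrix (Fin 2) (Fin 2) K) 0 1 := by rw [hmat]; simp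
  rw [e10]
  exact ⟨hmat, hskew⟩
include hσv hJ in
/-- **A torus element with `v(t₀₀ − 1) ≤ γ`, `v(t₁₁ − 1) ≤ γ` (`γ < 1`) lies in the level `K_γ`** (its inverse is `diag(σ t₁₁, σ t₀₀)`, `σ` isometric).
[cite: Casselman1995, Prop. 1.4.4] -/
theorem coe_mem_congruenceGL_of_mem_torusU {γ : ValueGroupWithZero K} (hγ : γ < 1) {t : ↥(unitaryGroupOfForm σ J)} (ht : t ∈ torusU σ J)
    (h0 : valuation K (((t : GL (Fin 2) K) : Matrix (Fin 2) (Fin 2) K) 0 0 - 1) ≤ γ)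
    (h1 : valuation K (((t : GL (Fin 2) K) : Matrix (Fin 2) (Fin 2) K) 1 1 - 1) ≤ γ) :
    (t : GL (Fin 2) K) ∈ congruenceGL 2 γ := by
  have hmat := coe_eq_diag_of_mem_torusU σ ht
  have hinv := coe_inv_eq_of_mem σ hJ t.2
  have e01 : ((t : GL (Fin 2) K) : Matrix (Fin 2) (Fin 2) K) 0 1 = 0 := by rw [hmat]; simp
  have e10 : ((t : GL (Fin 2) K) : Matrix (Fin 2) (Fin 2) K) 1 0 = 0 := by rw [hmat]; simp
  rw [e01, e10, map_zero] at hinv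
  set a : K := ((t : GL (Fin 2) K) : Matrix (Fin 2) (Fin 2) K) 0 0 with ha
  set b : K := ((t : GL (Fin 2) K) : Matrix (Fin 2) (Fin 2) K) 1 1 with hb
  have hva : valuation K a = 1 := valuation_eq_one_of_sub_one_le hγ h0
  have hvb : valuation K b = 1 := valuation_eq_one_of_sub_one_le hγ h1
  have hσa : valuation K (σ a - 1) ≤ γ := by rw [← map_one σ, ← map_sub, hσv]; exact h0
  have hσb : valuation K (σ b - 1) ≤ γ := by rw [← map_one σ, ← map_sub, hσv]; exact h1
  have hγ1 : γ ≤ 1 := hγ.le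
  rw [mem_congruenceGL_iff, hinv, hmat]
  refine ⟨⟨?_, ?_⟩, ?_, ?_⟩ <;> intro i j <;> fin_cases i <;> fin_cases j <;>
    simp [hva, hvb, hσv, hσa, hσb, h0, h1]

/-! ## §2 The orbit–tube inclusion -/
include hσv hJ in
/-- **ORBIT-TUBE₂ «⊆»: `k·(sτ)·k⁻¹ = s·ū(Z)·m·u(Y)` with `v(Z) ≤ γ·v(a−1)`, `m ∈ M ∩ K_γ`, `v(Y) ≤ γ·v(a⁻¹−1)`** for `k ∈ K_γ`, `τ ∈ M ∩ K_γ`, `s ∈ M` with root value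
`a = s₀₀·σ(s₀₀) ≠ 1` and `γ < 1` small w.r.t. `s` (`γ·v(a) < v(a−1)`, `γ < v(a−1)`, `γ·v(a⁻¹−1) ≤ 1`) — module docstring.
[cite: HarishChandra1970, Lemma 22] [cite: vanDijk1972, §2] [cite: Casselman1995, Prop. 1.4.4] -/
theorem conj_mul_mem_orbitTube {γ : ValueGroupWithZero K} (hγ : γ < 1)
    {s τ k : ↥(unitaryGroupOfForm σ J)} (hs : s ∈ torusU σ J) (hτ : τ ∈ torusU σ J)
    (hτK : (τ : GL (Fin 2) K) ∈ congruenceGL 2 γ) (hk : (k : GL (Fin 2) K) ∈ congruenceGL 2 γ)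
    (ha1 : ((s : GL (Fin 2) K) : Matrix (Fin 2) (Fin 2) K) 0 0 * σ (((s : GL (Fin 2) K) : Matrix (Fin 2) (Fin 2) K) 0 0) ≠ 1)
    (hγ1 : γ * valuation K (((s : GL (Fin 2) K) : Matrix (Fin 2) (Fin 2) K) 0 0 * σ (((s : GL (Fin 2) K) : Matrix (Fin 2) (Fin 2) K) 0 0)) <
      valuation K (((s : GL (Fin 2) K) : Matrix (Fin 2) (Fin 2) K) 0 0 * σ (((s : GL (Fin 2) K) : Matrix (Fin 2) (Fin 2) K) 0 0) - 1))
    (hγ2 : γ < valuation K (((s : GL (Fin 2) K) : Matrix (Fin 2) (Fin 2) K) 0 0 * σ (((s : GL (Fin 2) K) : Matrix (Fin 2) (Fin 2) K) 0 0) - 1))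
    (hγ3 : γ * valuation K ((((s : GL (Fin 2) K) : Matrix (Fin 2) (Fin 2) K) 0 0 * σ (((s : GL (Fin 2) K) : Matrix (Fin 2) (Fin 2) K) 0 0))⁻¹ - 1) ≤ 1) :
    ∃ nb m n : ↥(unitaryGroupOfForm σ J),
      ((nb : GL (Fin 2) K) : Matrix (Fin 2) (Fin 2) K) = !![1, 0; ((nb : GL (Fin 2) K) : Matrix (Fin 2) (Fin 2) K) 1 0, 1] ∧
      valuation K (((nb : GL (Fin 2) K) : Matrix (Fin 2) (Fin 2) K) 1 0) ≤
        γ * valuation K (((s : GL (Fin 2) K) : Matrix (Fin 2) (Fin 2) K) 0 0 * σ (((s : GL (Fin 2) K) : Matrix (Fin 2) (Fin 2) K) 0 0) - 1) ∧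
      m ∈ torusU σ J ∧ (m : GL (Fin 2) K) ∈ congruenceGL 2 γ ∧
      ((n : GL (Fin 2) K) : Matrix (Fin 2) (Fin 2) K) = !![1, ((n : GL (Fin 2) K) : Matrix (Fin 2) (Fin 2) K) 0 1; 0, 1] ∧
      valuation K (((n : GL (Fin 2) K) : Matrix (Fin 2) (Fin 2) K) 0 1) ≤
        γ * valuation K ((((s : GL (Fin 2) K) : Matrix (Fin 2) (Fin 2) K) 0 0 * σ (((s : GL (Fin 2) K) : Matrix (Fin 2) (Fin 2) K) 0 0))⁻¹ - 1) ∧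
      k * (s * τ) * k⁻¹ = s * (nb * m * n) := by
  subst hJ
  -- ### (0) the torus entries of `s` and `τ`
  obtain ⟨hde, hed⟩ := map_entry_mul_entry_eq_one_of_mem_torusU σ rfl hs
  have hsmat := coe_eq_diag_of_mem_torusU σ hs
  obtain ⟨hde1, hed1⟩ := map_entry_mul_entry_eq_one_of_mem_torusU σ rfl hτ
  have hτmat := coe_eq_diag_of_mem_torusU σ hτ
  have hsinv := coe_inv_eq_of_mem σ rfl s.2
  set d : K := ((s : GL (Fin 2) K) : Matrix (Fin 2) (Fin 2) K) 0 0 with hd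
  set e : K := ((s : GL (Fin 2) K) : Matrix (Fin 2) (Fin 2) K) 1 1 with he
  set d₁ : K := ((τ : GL (Fin 2) K) : Matrix (Fin 2) (Fin 2) K) 0 0 with hd₁
  set e₁ : K := ((τ : GL (Fin 2) K) : Matrix (Fin 2) (Fin 2) K) 1 1 with he₁
  have es01 : ((s : GL (Fin 2) K) : Matrix (Fin 2) (Fin 2) K) 0 1 = 0 := by rw [hsmat]; simp
  have es10 : ((s : GL (Fin 2) K) : Matrix (Fin 2) (Fin 2) K) 1 0 = 0 := by rw [hsmat]; simp
  rw [es01, es10, map_zero] at hsinv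
  have hd1 : valuation K (d₁ - 1) ≤ γ := valuation_apply_sub_one_le_of_mem_congruenceGL hτK 0
  have he1 : valuation K (e₁ - 1) ≤ γ := valuation_apply_sub_one_le_of_mem_congruenceGL hτK 1
  have hvd1 : valuation K d₁ = 1 := valuation_eq_one_of_sub_one_le hγ hd1
  have hve1 : valuation K e₁ = 1 := valuation_eq_one_of_sub_one_le hγ he1
  -- `e ≠ 0` (as `σd · e = 1`), `|σ d| · |e| = 1`
  have he0 : e ≠ 0 := fun h => by rw [h, mul_zero] at hde; exact zero_ne_one hde
  have hve : valuation K d * valuation K e = 1 := by rw [← hσv d, ← map_mul, hde, map_one]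
  -- ### (1) the Iwahori factorisation `k = n̄₀ τ₀ n₀`
  have hkK : k ∈ ((congruenceGL 2 γ).comap (unitaryGroupOfForm σ ((StdForm.antidiagonal 2).over K)).subtype : Subgroup _) := hk
  have hkset : k ∈ (((congruenceGL 2 γ).comap (unitaryGroupOfForm σ ((StdForm.antidiagonal 2).over K)).subtype : Subgroup _) : Set _) := hkK
  rw [coe_level_eq_mul σ rfl hγ] at hkset
  obtain ⟨x, hx, n₀, hn₀, hk_eq⟩ := Set.mem_mul.1 hkset
  obtain ⟨nb₀, hnb₀, τ₀, hτ₀, rfl⟩ := Set.mem_mul.1 hx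
  rw [SetLike.mem_coe, Subgroup.mem_inf] at hnb₀ hτ₀ hn₀
  obtain ⟨hnb₀K, hnb₀N⟩ := hnb₀
  obtain ⟨hτ₀K, hτ₀M⟩ := hτ₀
  obtain ⟨hn₀K, hn₀N⟩ := hn₀
  rw [Subgroup.mem_comap, Subgroup.coe_subtype] at hnb₀K hτ₀K hn₀K
  rw [borelTriple_N] at hn₀N hnb₀N
  rw [borelTriple_M] at hτ₀M
  -- ### (2) the coordinates `y`, `z`, `d₀`, `e₀`
  have hn₀mat : ((n₀ : GL (Fin 2) K) : Matrix (Fin 2) (Fin 2) K) = !![1, ((n₀ : GL (Fin 2) K) : Matrix (Fin 2) (Fin 2) K) 0 1; 0, 1] :=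
    coe_eq_of_mem_unipotentU_two σ hn₀N
  set y : K := ((n₀ : GL (Fin 2) K) : Matrix (Fin 2) (Fin 2) K) 0 1 with hy
  have hyskew : y + σ y = 0 := entry_add_map_entry_eq_zero_of_mem_unipotentU σ rfl hn₀N
  have hσy : σ y = -y := by linear_combination hyskew
  have hvy : valuation K y ≤ γ := valuation_apply_le_of_mem_congruenceGL hn₀K (by decide : (0 : Fin 2) ≠ 1)
  obtain ⟨hnb₀mat, hzskew⟩ := coe_eq_lower_of_mem_conj_unipotentU σ rfl hnb₀N
  set z : K := ((nb₀ : GL (Fin 2) K) : Matrix (Fin 2) (Fin 2) K) 1 0 with hz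
  have hσz : σ z = -z := by linear_combination hzskew
  have hvz : valuation K z ≤ γ := valuation_apply_le_of_mem_congruenceGL hnb₀K (by decide : (1 : Fin 2) ≠ 0)
  obtain ⟨hde0, hed0⟩ := map_entry_mul_entry_eq_one_of_mem_torusU σ rfl hτ₀M
  have hτ₀mat := coe_eq_diag_of_mem_torusU σ hτ₀M
  set d₀ : K := ((τ₀ : GL (Fin 2) K) : Matrix (Fin 2) (Fin 2) K) 0 0 with hd₀
  set e₀ : K := ((τ₀ : GL (Fin 2) K) : Matrix (Fin 2) (Fin 2) K) 1 1 with he₀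
  have hvd0 : valuation K d₀ = 1 := valuation_eq_one_of_sub_one_le hγ (valuation_apply_sub_one_le_of_mem_congruenceGL hτ₀K 0)
  -- ### (3) the matrices of `k` and `k⁻¹`
  have hkmat : ((k : GL (Fin 2) K) : Matrix (Fin 2) (Fin 2) K) = !![d₀, d₀ * y; z * d₀, z * d₀ * y + e₀] := by
    rw [← hk_eq, Subgroup.coe_mul, Subgroup.coe_mul, Units.val_mul, Units.val_mul, hnb₀mat, hτ₀mat, hn₀mat]
    simp only [Matrix.mul_fin_two]; congr 1; ring_nf
  have hkinv : (((k : GL (Fin 2) K)⁻¹ : GL (Fin 2) K) : Matrix (Fin 2) (Fin 2) K) = !![z * y * σ d₀ + σ e₀, -(y * σ d₀); -(z * σ d₀), σ d₀] := by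
    rw [coe_inv_eq_of_mem σ rfl k.2, hkmat]
    simp only [Matrix.of_apply, Matrix.cons_val', Matrix.cons_val_zero, Matrix.cons_val_one, Matrix.empty_val', Matrix.cons_val_fin_one,
      map_add, map_mul, hσz, hσy]
    congr 1; ext i j; fin_cases i <;> fin_cases j <;> simp <;> ring
  -- ### (4) the conjugate `k (sτ) k⁻¹` and the element `W = s⁻¹ k (sτ) k⁻¹`, as matrices
  have hKK : (((k * (s * τ) * k⁻¹ : ↥(unitaryGroupOfForm σ ((StdForm.antidiagonal 2).over K))) : GL (Fin 2) K) : Matrix (Fin 2) (Fin 2) K) =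
      !![d * d₁ + d₀ * σ d₀ * y * z * (d * d₁ - e * e₁), d₀ * σ d₀ * y * (e * e₁ - d * d₁);
         z * (d * d₁ - e * e₁) * (1 + d₀ * σ d₀ * y * z), e * e₁ + d₀ * σ d₀ * y * z * (e * e₁ - d * d₁)] := by
    rw [Subgroup.coe_mul, Subgroup.coe_mul, Subgroup.coe_mul, Subgroup.coe_inv, Units.val_mul, Units.val_mul, Units.val_mul, hkmat, hkinv, hsmat, hτmat]
    ext i j
    fin_cases i <;> fin_cases j
    · simp [Matrix.mul_apply, Fin.sum_univ_two]
      linear_combination (d * d₁) * hed0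
    · simp [Matrix.mul_apply, Fin.sum_univ_two]
      ring
    · simp [Matrix.mul_apply, Fin.sum_univ_two]
      linear_combination (z * (d * d₁)) * hed0 - (z * (e * e₁)) * hde0
    · simp [Matrix.mul_apply, Fin.sum_univ_two]
      linear_combination (e * e₁) * hde0
  set W : ↥(unitaryGroupOfForm σ ((StdForm.antidiagonal 2).over K)) := s⁻¹ * (k * (s * τ) * k⁻¹) with hW
  have hWmat : ((W : GL (Fin 2) K) : Matrix (Fin 2) (Fin 2) K) =
      !![σ e * (d * d₁ + d₀ * σ d₀ * y * z * (d * d₁ - e * e₁)), σ e * (d₀ * σ d₀ * y * (e * e₁ - d * d₁));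
         σ d * (z * (d * d₁ - e * e₁) * (1 + d₀ * σ d₀ * y * z)), σ d * (e * e₁ + d₀ * σ d₀ * y * z * (e * e₁ - d * d₁))] := by
    rw [hW, Subgroup.coe_mul, Subgroup.coe_inv, Units.val_mul, hsinv, hKK]
    ext i j
    fin_cases i <;> fin_cases j <;> simp [Matrix.mul_apply, Fin.sum_univ_two]
  -- ### (5) valuations
  have hva : valuation K (d * σ d) = valuation K d * valuation K d := by rw [map_mul, hσv]
  have hvdne : valuation K d ≠ 0 := by
    intro h; rw [h, zero_mul] at hve; exact zero_ne_one hve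
  have hdne : d ≠ 0 := fun h => hvdne (by rw [h, map_zero])
  have hveq : valuation K e = (valuation K d)⁻¹ := eq_inv_of_mul_eq_one_right hve
  have haed : d * σ d * e = d := by rw [mul_assoc, hde, mul_one]
  -- `v(d d₁ − e e₁) = v(e) · v(a − 1)`
  have hfactor : d * d₁ - e * e₁ = e * ((d * σ d - 1) + ((d * σ d) * (d₁ - 1) - (e₁ - 1))) := by
    linear_combination (-d₁) * haed
  have hsmall : valuation K ((d * σ d) * (d₁ - 1) - (e₁ - 1)) < valuation K (d * σ d - 1) := by
    refine lt_of_le_of_lt (Valuation.map_sub _ _ _) (max_lt ?_ ?_)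
    · rw [map_mul]
      calc valuation K (d * σ d) * valuation K (d₁ - 1) ≤ valuation K (d * σ d) * γ := mul_le_mul' le_rfl hd1
        _ = γ * valuation K (d * σ d) := mul_comm _ _
        _ < valuation K (d * σ d - 1) := hγ1
    · exact he1.trans_lt hγ2
  have hvDE : valuation K (d * d₁ - e * e₁) = valuation K e * valuation K (d * σ d - 1) := by
    rw [hfactor, map_mul, Valuation.map_add_eq_of_lt_left _ hsmall]
  have hvDE' : valuation K (e * e₁ - d * d₁) = valuation K e * valuation K (d * σ d - 1) := by
    rw [Valuation.map_sub_swap, hvDE]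
  -- `v(a⁻¹ − 1) = v(a − 1) · v(e)²`
  have hane : d * σ d ≠ 0 := by
    intro h; rw [h, zero_mul] at haed; exact hdne haed.symm
  have hvainv : valuation K ((d * σ d)⁻¹ - 1) = valuation K (d * σ d - 1) * (valuation K e * valuation K e) := by
    have : (d * σ d)⁻¹ - 1 = -((d * σ d - 1) * (d * σ d)⁻¹) := by rw [sub_mul, mul_inv_cancel₀ hane]; ring
    rw [this, Valuation.map_neg, map_mul, map_inv₀, hva, hveq, mul_inv]
  have hva0 : valuation K (d₀ * σ d₀) = 1 := by rw [map_mul, hσv, hvd0, one_mul]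
  have hvyz1 : valuation K (d₀ * σ d₀ * y * z) < 1 := by
    rw [map_mul, map_mul, hva0, one_mul]
    calc valuation K y * valuation K z ≤ γ * γ := mul_le_mul' hvy hvz
      _ ≤ γ * 1 := mul_le_mul' le_rfl hγ.le
      _ < 1 := by rw [mul_one]; exact hγ
  have hv1yz : valuation K (1 + d₀ * σ d₀ * y * z) = 1 := Valuation.map_one_add_of_lt _ hvyz1
  -- the three entries of `W`
  have hvW10 : valuation K (σ d * (z * (d * d₁ - e * e₁) * (1 + d₀ * σ d₀ * y * z))) ≤ γ * valuation K (d * σ d - 1) := by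
    rw [map_mul, map_mul, map_mul, hσv, hvDE, hv1yz, mul_one]
    calc valuation K d * (valuation K z * (valuation K e * valuation K (d * σ d - 1)))
        = (valuation K d * valuation K e) * (valuation K z * valuation K (d * σ d - 1)) := by ac_rfl
      _ = valuation K z * valuation K (d * σ d - 1) := by rw [hve, one_mul]
      _ ≤ γ * valuation K (d * σ d - 1) := mul_le_mul' hvz le_rfl
  have hvW01 : valuation K (σ e * (d₀ * σ d₀ * y * (e * e₁ - d * d₁))) ≤ γ * valuation K ((d * σ d)⁻¹ - 1) := by
    rw [map_mul, map_mul, map_mul, hσv, hva0, one_mul, hvDE', hvainv]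
    calc valuation K e * (valuation K y * (valuation K e * valuation K (d * σ d - 1)))
        = valuation K y * (valuation K (d * σ d - 1) * (valuation K e * valuation K e)) := by ac_rfl
      _ ≤ γ * (valuation K (d * σ d - 1) * (valuation K e * valuation K e)) := mul_le_mul' hvy le_rfl
  have hW00eq : σ e * (d * d₁ + d₀ * σ d₀ * y * z * (d * d₁ - e * e₁)) = d₁ + σ e * (d₀ * σ d₀) * (y * z) * (d * d₁ - e * e₁) := by
    linear_combination d₁ * hed
  have hvcorr : valuation K (σ e * (d₀ * σ d₀) * (y * z) * (d * d₁ - e * e₁)) ≤ γ := by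
    rw [map_mul, map_mul, map_mul, hσv, hva0, mul_one, map_mul (valuation K) y z, hvDE]
    calc valuation K e * (valuation K y * valuation K z) * (valuation K e * valuation K (d * σ d - 1))
        = (valuation K y * (valuation K (d * σ d - 1) * (valuation K e * valuation K e))) * valuation K z := by ac_rfl
      _ = (valuation K y * valuation K ((d * σ d)⁻¹ - 1)) * valuation K z := by rw [hvainv]
      _ ≤ (γ * valuation K ((d * σ d)⁻¹ - 1)) * γ := mul_le_mul' (mul_le_mul' hvy le_rfl) hvz
      _ ≤ 1 * γ := mul_le_mul' hγ3 le_rfl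
      _ = γ := one_mul γ
  have hvW00 : valuation K (σ e * (d * d₁ + d₀ * σ d₀ * y * z * (d * d₁ - e * e₁)) - 1) ≤ γ := by
    rw [hW00eq, show d₁ + σ e * (d₀ * σ d₀) * (y * z) * (d * d₁ - e * e₁) - 1 = (d₁ - 1) + σ e * (d₀ * σ d₀) * (y * z) * (d * d₁ - e * e₁) by ring]
    exact Valuation.map_add_le _ hd1 hvcorr
  have hW00 : valuation K (((W : GL (Fin 2) K) : Matrix (Fin 2) (Fin 2) K) 0 0 - 1) ≤ γ := by rw [hWmat]; simpa using hvW00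
  have hvW00one : valuation K (((W : GL (Fin 2) K) : Matrix (Fin 2) (Fin 2) K) 0 0) = 1 := valuation_eq_one_of_sub_one_le hγ hW00
  have hW00ne : ((W : GL (Fin 2) K) : Matrix (Fin 2) (Fin 2) K) 0 0 ≠ 0 := by
    intro h; rw [h, map_zero] at hvW00one; exact zero_ne_one hvW00one
  -- ### (6) the big-cell decomposition of `W`
  obtain ⟨nb, m, n, hnb, hmT, hmmat, hnmat, hWeq⟩ :=
    exists_lower_torus_upper_of_mul_entry_eq_one σ rfl (g := W) (p' := (((W : GL (Fin 2) K) : Matrix (Fin 2) (Fin 2) K) 0 0)⁻¹) (inv_mul_cancel₀ hW00ne)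
  have hvp : valuation K ((((W : GL (Fin 2) K) : Matrix (Fin 2) (Fin 2) K) 0 0)⁻¹) = 1 := by rw [map_inv₀, hvW00one, inv_one]
  -- the torus factor lies in `K_γ`
  obtain ⟨hm01, hm10⟩ := map_entry_mul_entry_eq_one_of_mem_torusU σ rfl hmT
  have hm00 : ((m : GL (Fin 2) K) : Matrix (Fin 2) (Fin 2) K) 0 0 = ((W : GL (Fin 2) K) : Matrix (Fin 2) (Fin 2) K) 0 0 := by rw [hmmat]; simp
  have hm11v : valuation K (((m : GL (Fin 2) K) : Matrix (Fin 2) (Fin 2) K) 1 1 - 1) ≤ γ := by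
    set b := ((m : GL (Fin 2) K) : Matrix (Fin 2) (Fin 2) K) 1 1 with hb
    rw [hm00] at hm01 hm10
    -- `b · σW₀₀ = 1`, so `b − 1 = b · (1 − σW₀₀)` … we use `σ b · W₀₀ = 1` instead: `σ(b − 1) = σ b − 1 = σ b (1 − W₀₀)`
    have hσ1 : σ b - 1 = σ b * (1 - ((W : GL (Fin 2) K) : Matrix (Fin 2) (Fin 2) K) 0 0) := by linear_combination hm10
    have hvσb : valuation K (σ b) = 1 := by
      have h := congrArg (valuation K) hm10
      rw [map_mul, hvW00one, mul_one, map_one] at h; exact h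
    rw [← hσv, map_sub, map_one, hσ1, map_mul, hvσb, one_mul, Valuation.map_sub_swap]; exact hW00
  have hmK : (m : GL (Fin 2) K) ∈ congruenceGL 2 γ := coe_mem_congruenceGL_of_mem_torusU σ hσv rfl hγ hmT (by rw [hm00]; exact hW00) hm11v
  -- ### (7) assemble
  refine ⟨nb, m, n, ?_, ?_, hmT, hmK, ?_, ?_, ?_⟩
  · rw [hnb]; simp
  · rw [hnb]
    simp only [Matrix.of_apply, Matrix.cons_val', Matrix.cons_val_zero, Matrix.cons_val_one, Matrix.empty_val', Matrix.cons_val_fin_one]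
    rw [map_mul, hvp, mul_one, hWmat]
    simpa using hvW10
  · rw [hnmat]; simp
  · rw [hnmat]
    simp only [Matrix.of_apply, Matrix.cons_val', Matrix.cons_val_zero, Matrix.cons_val_one, Matrix.empty_val', Matrix.cons_val_fin_one]
    rw [map_mul, hvp, one_mul, hWmat]
    simpa using hvW01
  · rw [← hWeq, hW, mul_inv_cancel_left]

end Summit.HodgeConjecture.HodgeConjecture.Cruxes.H413.F0P3cStCharTSUpTrU2OrbitTube
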